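import Mathlib
import Literature.RingTheory.CohomologyAnnihilator.Basic
import Literature.RingTheory.CohomologyAnnihilator.RegularRing
import Literature.RingTheory.CohomologyAnnihilator.Localization
import Summits.ResolutionOfSingularities.ResolutionOfSingularities.Theorems.HomologicalConductorPersistenceRetractEngine
import HarnessLib

/-!
# Exponent two at level four on the Veronese cylinder: `(𝔪_V R)² ⊆ ca⁴(R)` in every characteristic

Crux `HomologicalConductor.Persistence` (stmt-ResolutionOfSingularities-16484), chain W4.4b, rung L1;
plan-1 ASSIGN v0.9 row «stub-3» (1) «exponent TWO at level 4: 𝔪_V² · T₁ ⊆ ca⁴(T₁) as a Theorems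
file --supports 16484» (CHAIN v5 §V5.2, CRUX-PLAN v5 §1.1 by-product (E1) «ESTABLISHED»; tri-2
MERGE-WORDING «exponent-two corollary 𝔪_V² ⊆ ca⁴ first (one file)»). `[OURS · L1 w44b]` — our own
by-product about ONE stage of the route's `ca`-tower (`T₁ = (V[u])_Q`, the normalised `ca`-chart of
the `A₂ × line` point, stub-2's kill candidate / DECISION D1); NOT a statement of the manuscript
under review and using none of its statements; AI-written (weaker than expert review).

## Statement

`R := k[a,b,u]^{(1,1,0) mod 3} = V[u]`, `V = k[a³, a²b, ab², b³]` the third Veronese of `k[a,b]`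
(the cone over the twisted cubic; the cyclic quotient singularity `1/3(1,1)` when `3 ∈ kˣ`), typed as
the subalgebra of `MvPolynomial (Fin 3) k` (`a = X 0`, `b = X 1`, `u = X 2`) of polynomials of
weighted degree `0` for the weights `![1, 1, 0] : Fin 3 → ZMod 3`, equivalently
(`mem_adjoin_veronese_iff`) `Algebra.adjoin k {a³, a²b, ab², b³, u}` — the form used by the chain
(idea-2's `veroneseCylinder`). With `𝔪_V R := (a³, a²b, ab², b³) R` (the ideal of the singular line):

* `veronese_sq_le_cohomologyAnnihilatorOfDegree_four` : `(𝔪_V R)² ≤ ca⁴(R)` — `k` ANY field;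
* `veronese_adjoin_sq_le_cohomologyAnnihilatorOfDegree_four` : the same for `Algebra.adjoin k {…}`;
* `veronese_sq_map_le_cohomologyAnnihilatorOfDegree_four` : `(𝔪_V L)² ≤ ca⁴(L)` for every
  localisation `L` of `R`, in particular the tower stage `T₁ = R_Q`, `Q = (𝔪_V, u)`
  ([IyengarTakahashi2014, Lemma 2.10(1)], tree `map_cohomologyAnnihilatorOfDegree_le_of_isLocalization`).

Context in the chain: level FOUR with exponent ONE is false there (N11: `a³ ∉ ca⁴(T₁)`, machine
evidence, `LevelFourPersistenceFails` in `Theorems/HomologicalConductorPersistenceLevel.lean`), so at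
level `4 = dim T₁ + 1` exponent two is the right statement; exponent ONE at level FIVE
(`𝔪_V T₁ ⊆ ca⁵(T₁)`, T-HOLD / `CubicsLevelFive`) remains the chain's open target and is NOT touched
here.

## Proof (characteristic-free)

The engine `PersistenceRetractEngine.span_pow_le_cohomologyAnnihilatorOfDegree` (same chain) with
`P = k[a,b,u]` (`ca⁴(P) = P`: Hilbert's syzygy theorem, tree
`cohomologyAnnihilatorOfDegree_mvPolynomial_eq_top k 3`), `e = 1`, and:
* `exists_retraction_of_degree_zero` — the degree-`0` component `p ↦ p₀` is an `R`-LINEAR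
  retraction `P → R` (a graded projection — no Reynolds averaging, so no hypothesis on `char k`);
* `exists_comp_eq_smul_id_of_graded` — GRADED SUPPLY: if `c ∈ R` factors as `c = y_g x_g` with
  `deg x_g = -g`, `deg y_g = g` for every `g ∈ ℤ/3`, then `c • 1_P = π ∘ ι` through `R³`
  (`ι p = ((x_g p)₀)_g`, `π r = Σ_g r_g y_g`, `π ι p = Σ_g y_g x_g p_g = c p`); every cubic
  `ℓ₁ℓ₂ℓ₃` in `a, b` so factors (`exists_split_of_triple`), in particular `a³, a²b, ab², b³`
  (`exists_split_of_mem_cubics`) — this is «`M₁[u]`, `M₂[u]` are stably annihilated by `𝔪_V`»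
  of card A4 with `P|_R = R ⊕ M₁[u] ⊕ M₂[u]`;
* `mem_adjoin_veronese_iff`, `X_pow_mul_X_pow_mem_adjoin` — `k[a³,a²b,ab²,b³,u]` IS the degree-`0`
  part (so `R` is noetherian, being finitely generated over `k`).

## References

* S. B. Iyengar, R. Takahashi, *Annihilation of cohomology and strong generation of module
  categories*, IMRN 2016; arXiv:1404.1476 — Def. 2.1, Lemma 2.10, Example 2.5. [`IyengarTakahashi2014`]
-/

-- single-problem summit: the doubled namespace component is forced
set_option linter.dupNamespace false

noncomputable section

open CategoryTheory CategoryTheory.Abelian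

universe u

namespace Summit.ResolutionOfSingularities.ResolutionOfSingularities.Theorems.HomologicalConductor.PersistenceVeroneseExponentTwo

open Literature.RingTheory.CohomologyAnnihilator
open Summit.ResolutionOfSingularities.ResolutionOfSingularities.Theorems.HomologicalConductor.PersistenceRetractEngine

/-! ## Graded supply: the degree-zero part of a weighted polynomial ring -/

section Graded

open MvPolynomial

variable {σ : Type*} {M : Type*} [AddCommGroup M] (k : Type u) [CommRing k] (w : σ → M)

/-- Transport of weighted homogeneity along an equality of degrees. [folklore] -/
theorem isWeightedHomogeneous_of_eq {φ : MvPolynomial σ k} {m m' : M}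
    (h : IsWeightedHomogeneous w φ m) (hm : m = m') : IsWeightedHomogeneous w φ m' :=
  hm ▸ h

/-- The weighted homogeneous component of a product with a weighted homogeneous left factor:
`(x p)_n = x · p_{n - i}` for `x` homogeneous of degree `i` (group-valued weights). [folklore] -/
theorem weightedHomogeneousComponent_mul_left {x : MvPolynomial σ k} {i : M}
    (hx : IsWeightedHomogeneous w x i) (n : M) (p : MvPolynomial σ k) :
    weightedHomogeneousComponent w n (x * p) = x * weightedHomogeneousComponent w (n - i) p := by
  classical
  ext d
  rw [coeff_weightedHomogeneousComponent, coeff_mul, coeff_mul]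
  split_ifs with hd
  · refine Finset.sum_congr rfl fun q hq => ?_
    rw [coeff_weightedHomogeneousComponent]
    by_cases h1 : coeff q.1 x = 0
    · simp [h1]
    · have hq1 : Finsupp.weight w q.1 = i := hx h1
      have hsum : i + Finsupp.weight w q.2 = n := by
        rw [← hq1, ← map_add, Finset.HasAntidiagonal.mem_antidiagonal.mp hq, hd]
      rw [if_pos (eq_sub_of_add_eq' hsum)]
  · symm
    refine Finset.sum_eq_zero fun q hq => ?_
    rw [coeff_weightedHomogeneousComponent]
    split_ifs with h2
    · by_cases h1 : coeff q.1 x = 0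
      · simp [h1]
      · exfalso
        apply hd
        rw [← Finset.HasAntidiagonal.mem_antidiagonal.mp hq, map_add, hx h1, h2]
        abel
    · simp

/-- **The Reynolds retraction onto the degree-zero part.** If `R₀ ⊆ k[σ]` is the subalgebra of
weighted-degree-`0` polynomials, the degree-`0` component `p ↦ p₀` is an `R₀`-LINEAR retraction
`k[σ] → R₀` of the inclusion (valid in every characteristic: no averaging). [folklore] -/
theorem exists_retraction_of_degree_zero (R₀ : Subalgebra k (MvPolynomial σ k))
    (hR₀ : ∀ p, p ∈ R₀ ↔ IsWeightedHomogeneous w p 0) :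
    ∃ ρ : MvPolynomial σ k →ₗ[R₀] R₀, (∀ r : R₀, ρ (r : MvPolynomial σ k) = r) ∧
      ∀ p, (ρ p : MvPolynomial σ k) = weightedHomogeneousComponent w 0 p := by
  refine ⟨{ toFun := fun p => ⟨weightedHomogeneousComponent w 0 p,
              (hR₀ _).mpr (weightedHomogeneousComponent_isWeightedHomogeneous 0 p)⟩
            map_add' := fun p q => by
              ext1
              simp
            map_smul' := fun r p => by
              ext1
              change weightedHomogeneousComponent w 0 (r • p) =
                (r : MvPolynomial σ k) * weightedHomogeneousComponent w 0 p
              rw [Subalgebra.smul_def, smul_eq_mul,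
                weightedHomogeneousComponent_mul_left k w ((hR₀ _).mp r.2), sub_zero] }, ?_, ?_⟩
  · intro r
    ext1
    exact weightedHomogeneousComponent_eq_self ((hR₀ _).mp r.2)
  · intro p
    rfl

/-- **Graded supply of stable annihilation.** Let `R₀ ⊆ k[σ]` be the weighted-degree-`0`
subalgebra for weights in a FINITE group `M`. If `c ∈ R₀` factors as `c = y_g x_g` with `x_g` of
degree `-g` and `y_g` of degree `g` for EVERY `g ∈ M`, then `c • 1_{k[σ]}` factors `R₀`-linearly
through the finite free module `R₀^M`: `ι p = ((x_g p)₀)_g`, `π r = Σ_g r_g y_g`, and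
`π ι p = Σ_g y_g x_g p_g = c p`. (For `k[a,b,u]` with weights `(1,1,0) mod 3` and `c` a cubic in
`a, b`: every such cubic is the product of three linear forms.) [folklore] -/
theorem exists_comp_eq_smul_id_of_graded [Fintype M] (R₀ : Subalgebra k (MvPolynomial σ k))
    (hR₀ : ∀ p, p ∈ R₀ ↔ IsWeightedHomogeneous w p 0) (c : R₀)
    (hc : ∀ g : M, ∃ x y : MvPolynomial σ k,
      IsWeightedHomogeneous w x (-g) ∧ IsWeightedHomogeneous w y g ∧ y * x = c) :
    ∃ (s : ℕ) (ι : MvPolynomial σ k →ₗ[R₀] (Fin s → R₀)) (π : (Fin s → R₀) →ₗ[R₀] MvPolynomial σ k),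
      π ∘ₗ ι = c • LinearMap.id := by
  classical
  obtain ⟨ρ, -, hρw⟩ := exists_retraction_of_degree_zero k w R₀ hR₀
  choose x y hx hy hxy using hc
  let e : M ≃ Fin (Fintype.card M) := Fintype.equivFin M
  let ι : MvPolynomial σ k →ₗ[R₀] (Fin (Fintype.card M) → R₀) :=
    { toFun := fun p a => ρ (x (e.symm a) * p)
      map_add' := fun p q => by
        funext a
        simp [mul_add]
      map_smul' := fun r p => by
        funext a
        change ρ (x (e.symm a) * (r • p)) = r • ρ (x (e.symm a) * p)
        rw [← map_smul ρ r]
        congr 1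
        rw [Subalgebra.smul_def, Subalgebra.smul_def, smul_eq_mul, smul_eq_mul, mul_left_comm] }
  let π : (Fin (Fintype.card M) → R₀) →ₗ[R₀] MvPolynomial σ k :=
    { toFun := fun r => ∑ a, (r a : MvPolynomial σ k) * y (e.symm a)
      map_add' := fun r r' => by
        simp [Finset.sum_add_distrib, add_mul]
      map_smul' := fun t r => by
        simp [Finset.mul_sum, mul_assoc, Subalgebra.smul_def] }
  refine ⟨Fintype.card M, ι, π, LinearMap.ext fun p => ?_⟩
  change (∑ a, ((ρ (x (e.symm a) * p) : R₀) : MvPolynomial σ k) * y (e.symm a)) = c • p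
  simp_rw [hρw, weightedHomogeneousComponent_mul_left k w (hx _), zero_sub, neg_neg]
  calc ∑ a, x (e.symm a) * weightedHomogeneousComponent w (e.symm a) p * y (e.symm a)
      = ∑ a, (c : MvPolynomial σ k) * weightedHomogeneousComponent w (e.symm a) p := by
        refine Finset.sum_congr rfl fun a _ => ?_
        rw [mul_right_comm, mul_comm (x _) (y _), hxy]
    _ = (c : MvPolynomial σ k) * ∑ g : M, weightedHomogeneousComponent w g p := by
        rw [← Finset.mul_sum, Equiv.sum_comp e.symm (fun g => weightedHomogeneousComponent w g p)]
    _ = c • p := by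
        rw [← finsum_eq_sum_of_fintype, sum_weightedHomogeneousComponent, Subalgebra.smul_def,
          smul_eq_mul]

end Graded

/-! ## The Veronese cylinder `k[a,b,u]^{(1,1,0) mod 3}` -/

section Veronese

open MvPolynomial

variable (k : Type u)

/-- `3 ∣ i + j` implies `aⁱ bʲ ∈ k[a³, a²b, ab², b³, u]`. [folklore] -/
theorem X_pow_mul_X_pow_mem_adjoin [CommRing k] (i j : ℕ) (h : 3 ∣ i + j) :
    (X 0 ^ i * X 1 ^ j : MvPolynomial (Fin 3) k) ∈ Algebra.adjoin k
      ({X 0 ^ 3, X 0 ^ 2 * X 1, X 0 * X 1 ^ 2, X 1 ^ 3, X 2} : Set (MvPolynomial (Fin 3) k)) := by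
  set A := Algebra.adjoin k
      ({X 0 ^ 3, X 0 ^ 2 * X 1, X 0 * X 1 ^ 2, X 1 ^ 3, X 2} : Set (MvPolynomial (Fin 3) k)) with hA
  have h0 : (X 0 ^ 3 : MvPolynomial (Fin 3) k) ∈ A := Algebra.subset_adjoin (by simp)
  have h1 : (X 1 ^ 3 : MvPolynomial (Fin 3) k) ∈ A := Algebra.subset_adjoin (by simp)
  have h21 : (X 0 ^ 2 * X 1 : MvPolynomial (Fin 3) k) ∈ A := Algebra.subset_adjoin (by simp)
  have h12 : (X 0 * X 1 ^ 2 : MvPolynomial (Fin 3) k) ∈ A := Algebra.subset_adjoin (by simp)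
  obtain ⟨qi, ri, hri, rfl⟩ : ∃ q r, r < 3 ∧ i = 3 * q + r :=
    ⟨i / 3, i % 3, Nat.mod_lt _ (by norm_num), (Nat.div_add_mod i 3).symm⟩
  obtain ⟨qj, rj, hrj, rfl⟩ : ∃ q r, r < 3 ∧ j = 3 * q + r :=
    ⟨j / 3, j % 3, Nat.mod_lt _ (by norm_num), (Nat.div_add_mod j 3).symm⟩
  have key : (X 0 ^ ri * X 1 ^ rj : MvPolynomial (Fin 3) k) ∈ A := by
    have hr : ri + rj = 0 ∨ ri + rj = 3 := by omega
    interval_cases ri <;> interval_cases rj <;> simp_all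
  rw [pow_add, pow_add, pow_mul, pow_mul, mul_mul_mul_comm]
  exact A.mul_mem (A.mul_mem (A.pow_mem h0 _) (A.pow_mem h1 _)) key

/-- **The Veronese cylinder as a degree-zero part**: `k[a³, a²b, ab², b³, u] ⊆ k[a, b, u]` is
exactly the subalgebra of polynomials of weighted degree `0` for the weights `(1, 1, 0)` with values
in `ℤ/3` (`a = X 0`, `b = X 1`, `u = X 2`). [folklore] -/
theorem mem_adjoin_veronese_iff [CommRing k] (p : MvPolynomial (Fin 3) k) :
    p ∈ Algebra.adjoin k
        ({X 0 ^ 3, X 0 ^ 2 * X 1, X 0 * X 1 ^ 2, X 1 ^ 3, X 2} : Set (MvPolynomial (Fin 3) k)) ↔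
      IsWeightedHomogeneous (![1, 1, 0] : Fin 3 → ZMod 3) p 0 := by
  set w : Fin 3 → ZMod 3 := ![1, 1, 0] with hw
  have ha : IsWeightedHomogeneous w (X 0 : MvPolynomial (Fin 3) k) 1 := isWeightedHomogeneous_X k w 0
  have hb : IsWeightedHomogeneous w (X 1 : MvPolynomial (Fin 3) k) 1 := isWeightedHomogeneous_X k w 1
  have hu : IsWeightedHomogeneous w (X 2 : MvPolynomial (Fin 3) k) 0 := isWeightedHomogeneous_X k w 2
  constructor
  · intro hp
    induction hp using Algebra.adjoin_induction with
    | mem x hx =>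
      simp only [Set.mem_insert_iff, Set.mem_singleton_iff] at hx
      rcases hx with rfl | rfl | rfl | rfl | rfl
      · exact isWeightedHomogeneous_of_eq k w (ha.pow 3) (by decide)
      · exact isWeightedHomogeneous_of_eq k w ((ha.pow 2).mul hb) (by decide)
      · exact isWeightedHomogeneous_of_eq k w (ha.mul (hb.pow 2)) (by decide)
      · exact isWeightedHomogeneous_of_eq k w (hb.pow 3) (by decide)
      · exact hu
    | algebraMap r => exact isWeightedHomogeneous_C w r
    | add x y _ _ hx hy => exact hx.add hy
    | mul x y _ _ hx hy => exact isWeightedHomogeneous_of_eq k w (hx.mul hy) (add_zero 0)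
  · intro hp
    rw [p.as_sum]
    refine Subalgebra.sum_mem _ fun d hd => ?_
    have hwd : Finsupp.weight w d = 0 := hp (mem_support_iff.mp hd)
    have h3 : 3 ∣ d 0 + d 1 := by
      rw [Finsupp.weight_apply, Finsupp.sum_fintype d (fun i c => c • w i) (fun i => zero_smul ℕ (w i)),
        Fin.sum_univ_three] at hwd
      have h01 : ((d 0 + d 1 : ℕ) : ZMod 3) = 0 := by
        simpa [hw, nsmul_eq_mul] using hwd
      exact (ZMod.natCast_eq_zero_iff _ _).mp h01
    rw [monomial_eq, Finsupp.prod_fintype _ _ (fun _ => pow_zero _), Fin.prod_univ_three]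
    refine Subalgebra.mul_mem _ (Subalgebra.algebraMap_mem _ _) ?_
    exact Subalgebra.mul_mem _ (X_pow_mul_X_pow_mem_adjoin k (d 0) (d 1) h3)
      (Subalgebra.pow_mem _ (Algebra.subset_adjoin (by simp)) _)

/-- Splitting of a product of three linear forms in `a, b` along the `ℤ/3`-grading: for every
`g ∈ ℤ/3`, `ℓ₁ℓ₂ℓ₃ = y_g x_g` with `x_g` of degree `-g` and `y_g` of degree `g`. [folklore] -/
theorem exists_split_of_triple [CommRing k] (ℓ₁ ℓ₂ ℓ₃ : MvPolynomial (Fin 3) k)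
    (h₁ : IsWeightedHomogeneous (![1, 1, 0] : Fin 3 → ZMod 3) ℓ₁ 1)
    (h₂ : IsWeightedHomogeneous (![1, 1, 0] : Fin 3 → ZMod 3) ℓ₂ 1)
    (h₃ : IsWeightedHomogeneous (![1, 1, 0] : Fin 3 → ZMod 3) ℓ₃ 1) (g : ZMod 3) :
    ∃ x y : MvPolynomial (Fin 3) k,
      IsWeightedHomogeneous (![1, 1, 0] : Fin 3 → ZMod 3) x (-g) ∧
      IsWeightedHomogeneous (![1, 1, 0] : Fin 3 → ZMod 3) y g ∧ y * x = ℓ₁ * ℓ₂ * ℓ₃ := by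
  set w : Fin 3 → ZMod 3 := ![1, 1, 0] with hw
  fin_cases g
  · exact ⟨1, ℓ₁ * ℓ₂ * ℓ₃, isWeightedHomogeneous_of_eq k w (isWeightedHomogeneous_one k w) (by decide),
      isWeightedHomogeneous_of_eq k w ((h₁.mul h₂).mul h₃) (by decide), mul_one _⟩
  · exact ⟨ℓ₁ * ℓ₂, ℓ₃, isWeightedHomogeneous_of_eq k w (h₁.mul h₂) (by decide),
      isWeightedHomogeneous_of_eq k w h₃ (by decide), by ring⟩
  · exact ⟨ℓ₁, ℓ₂ * ℓ₃, isWeightedHomogeneous_of_eq k w h₁ (by decide),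
      isWeightedHomogeneous_of_eq k w (h₂.mul h₃) (by decide), by ring⟩

/-- The four cubics `a³, a²b, ab², b³` split along the `ℤ/3`-grading of `k[a,b,u]`. [folklore] -/
theorem exists_split_of_mem_cubics [CommRing k] (c : MvPolynomial (Fin 3) k)
    (hc : c ∈ ({X 0 ^ 3, X 0 ^ 2 * X 1, X 0 * X 1 ^ 2, X 1 ^ 3} : Set (MvPolynomial (Fin 3) k)))
    (g : ZMod 3) :
    ∃ x y : MvPolynomial (Fin 3) k,
      IsWeightedHomogeneous (![1, 1, 0] : Fin 3 → ZMod 3) x (-g) ∧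
      IsWeightedHomogeneous (![1, 1, 0] : Fin 3 → ZMod 3) y g ∧ y * x = c := by
  set w : Fin 3 → ZMod 3 := ![1, 1, 0] with hw
  have ha : IsWeightedHomogeneous w (X 0 : MvPolynomial (Fin 3) k) 1 := isWeightedHomogeneous_X k w 0
  have hb : IsWeightedHomogeneous w (X 1 : MvPolynomial (Fin 3) k) 1 := isWeightedHomogeneous_X k w 1
  simp only [Set.mem_insert_iff, Set.mem_singleton_iff] at hc
  rcases hc with rfl | rfl | rfl | rfl
  · obtain ⟨x, y, hx, hy, e⟩ := exists_split_of_triple k _ _ _ ha ha ha g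
    exact ⟨x, y, hx, hy, by rw [e]; ring⟩
  · obtain ⟨x, y, hx, hy, e⟩ := exists_split_of_triple k _ _ _ ha ha hb g
    exact ⟨x, y, hx, hy, by rw [e]; ring⟩
  · obtain ⟨x, y, hx, hy, e⟩ := exists_split_of_triple k _ _ _ ha hb hb g
    exact ⟨x, y, hx, hy, by rw [e]; ring⟩
  · obtain ⟨x, y, hx, hy, e⟩ := exists_split_of_triple k _ _ _ hb hb hb g
    exact ⟨x, y, hx, hy, by rw [e]; ring⟩

/-- **Exponent two at level four, degree-zero form (all characteristics).** Let `R ⊆ k[a,b,u]` be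
the subalgebra of weighted-degree-`0` polynomials for the weights `(1,1,0) mod 3` — the Veronese
cylinder `V[u]`, `V = k[a,b]^{(3)} = k[a³,a²b,ab²,b³]` the cone over the twisted cubic
(`= 1/3(1,1)` when `3 ∈ kˣ`). Then for the ideal `𝔪_V R = (a³, a²b, ab², b³) R` of the singular
line: `(𝔪_V R)² ⊆ ca⁴(R)`, i.e. every product of two cubics kills `Extⁱ_R(M, N)` for all finitely
generated `M`, `N` and all `i ≥ 4 = dim R + 1`. [OURS · L1 w44b, by-product (E1); folklore
method] -/
theorem veronese_sq_le_cohomologyAnnihilatorOfDegree_four [Field k]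
    (R : Subalgebra k (MvPolynomial (Fin 3) k))
    (hR : ∀ p, p ∈ R ↔ IsWeightedHomogeneous (![1, 1, 0] : Fin 3 → ZMod 3) p 0) :
    Ideal.span (((↑) : R → MvPolynomial (Fin 3) k) ⁻¹'
        {X 0 ^ 3, X 0 ^ 2 * X 1, X 0 * X 1 ^ 2, X 1 ^ 3}) ^ 2 ≤
      cohomologyAnnihilatorOfDegree R 4 := by
  set w : Fin 3 → ZMod 3 := ![1, 1, 0] with hw
  -- `R` is the finitely generated algebra `k[a³, a²b, ab², b³, u]`, hence noetherian
  have hR' : R = Algebra.adjoin k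
      ({X 0 ^ 3, X 0 ^ 2 * X 1, X 0 * X 1 ^ 2, X 1 ^ 3, X 2} : Set (MvPolynomial (Fin 3) k)) := by
    ext p
    rw [hR, mem_adjoin_veronese_iff]
  haveI : Algebra.FiniteType k R := by
    rw [← Subalgebra.fg_iff_finiteType, Subalgebra.fg_def]
    exact ⟨_, ((((Set.finite_singleton _).insert _).insert _).insert _).insert _, hR'.symm⟩
  haveI : IsNoetherianRing R := Algebra.FiniteType.isNoetherianRing k R
  obtain ⟨ρ, hρ, -⟩ := exists_retraction_of_degree_zero k w R hR
  have hP : cohomologyAnnihilatorOfDegree (MvPolynomial (Fin 3) k) (1 + 3) = ⊤ :=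
    cohomologyAnnihilatorOfDegree_mvPolynomial_eq_top k 3
  have h := span_pow_le_cohomologyAnnihilatorOfDegree (R := R) (P := MvPolynomial (Fin 3) k) ρ
    (fun r => hρ r) (S := ((↑) : R → MvPolynomial (Fin 3) k) ⁻¹'
        {X 0 ^ 3, X 0 ^ 2 * X 1, X 0 * X 1 ^ 2, X 1 ^ 3}) (fun c hc => ?_) 1 hP
  · exact h
  · exact exists_comp_eq_smul_id_of_graded k w R hR c (exists_split_of_mem_cubics k (c : _) hc)

/-- The same for the named subalgebra `k[a³, a²b, ab², b³, u] = Algebra.adjoin k {…}` (the form in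
which the w44b chain writes the Veronese cylinder). [OURS · L1 w44b] -/
theorem veronese_adjoin_sq_le_cohomologyAnnihilatorOfDegree_four [Field k] :
    Ideal.span (((↑) : ↥(Algebra.adjoin k ({X 0 ^ 3, X 0 ^ 2 * X 1, X 0 * X 1 ^ 2, X 1 ^ 3, X 2} :
        Set (MvPolynomial (Fin 3) k))) → MvPolynomial (Fin 3) k) ⁻¹'
        {X 0 ^ 3, X 0 ^ 2 * X 1, X 0 * X 1 ^ 2, X 1 ^ 3}) ^ 2 ≤
      cohomologyAnnihilatorOfDegree ↥(Algebra.adjoin k ({X 0 ^ 3, X 0 ^ 2 * X 1, X 0 * X 1 ^ 2,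
        X 1 ^ 3, X 2} : Set (MvPolynomial (Fin 3) k))) 4 :=
  veronese_sq_le_cohomologyAnnihilatorOfDegree_four k _ (mem_adjoin_veronese_iff k)

/-- **Exponent two at level four at the tower stage `T₁ = R_Q`** (and at any localisation `L` of
the Veronese cylinder `R`): `(𝔪_V L)² ⊆ ca⁴(L)`, by `caⁿ(R) L ⊆ caⁿ(L)`
(`map_cohomologyAnnihilatorOfDegree_le_of_isLocalization`, [IyengarTakahashi2014, Lemma 2.10]).
[OURS · L1 w44b] -/
theorem veronese_sq_map_le_cohomologyAnnihilatorOfDegree_four [Field k]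
    (R : Subalgebra k (MvPolynomial (Fin 3) k))
    (hR : ∀ p, p ∈ R ↔ IsWeightedHomogeneous (![1, 1, 0] : Fin 3 → ZMod 3) p 0)
    (U : Submonoid R) (L : Type u) [CommRing L] [Algebra R L] [IsLocalization U L] :
    (Ideal.span (((↑) : R → MvPolynomial (Fin 3) k) ⁻¹'
        {X 0 ^ 3, X 0 ^ 2 * X 1, X 0 * X 1 ^ 2, X 1 ^ 3})).map (algebraMap R L) ^ 2 ≤
      cohomologyAnnihilatorOfDegree L 4 := by
  have hR' : R = Algebra.adjoin k
      ({X 0 ^ 3, X 0 ^ 2 * X 1, X 0 * X 1 ^ 2, X 1 ^ 3, X 2} : Set (MvPolynomial (Fin 3) k)) := by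
    ext p
    rw [hR, mem_adjoin_veronese_iff]
  haveI : Algebra.FiniteType k R := by
    rw [← Subalgebra.fg_iff_finiteType, Subalgebra.fg_def]
    exact ⟨_, ((((Set.finite_singleton _).insert _).insert _).insert _).insert _, hR'.symm⟩
  haveI : IsNoetherianRing R := Algebra.FiniteType.isNoetherianRing k R
  rw [← Ideal.map_pow]
  exact (Ideal.map_mono (veronese_sq_le_cohomologyAnnihilatorOfDegree_four k R hR)).trans
    (map_cohomologyAnnihilatorOfDegree_le_of_isLocalization U L 4)

end Veronese

/-! ## Appendix: any finite abelian grading, any number of variables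
The Veronese cylinder is the case `e = 1`, `M = ℤ/3`, `w = (1,1,0)`; at the stages `1/r(1,q) × 𝔸ʲ`
of the chain's kill hunt «`c` splits in every degree» reads `c ∈ ⋂_χ τ(M_χ)` (trace ideals). -/

section GradedGeneral

open MvPolynomial

/-- **Exponent `e + 1` at level `e + 3` for degree-zero subrings of finitely graded polynomial
rings** (all characteristics). Let `P = k[x₁, …, x_{e+2}]` be graded by a finite abelian group `M`
through weights `w`, `R = P₀` its degree-`0` subalgebra (assumed noetherian — it is finitely
generated, which we do not re-prove in this generality), and `S ⊆ R` a set of elements each of which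
SPLITS IN EVERY DEGREE: `c = y_g x_g` with `deg x_g = -g`, `deg y_g = g` for all `g ∈ M`. Then
`(S)^{e+1} ⊆ caᵉ⁺³(R)`: the engine `span_pow_le_cohomologyAnnihilatorOfDegree` with the graded
retraction and the graded supply, `caᵉ⁺³(P) = P` being Hilbert's syzygy theorem. [OURS · L1 w44b;
folklore method] -/
theorem graded_span_pow_le_cohomologyAnnihilatorOfDegree (k : Type u) [Field k] {M : Type*}
    [AddCommGroup M] [Fintype M] {e : ℕ} (w : Fin (e + 2) → M)
    (R : Subalgebra k (MvPolynomial (Fin (e + 2)) k))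
    (hR : ∀ p, p ∈ R ↔ IsWeightedHomogeneous w p 0) [IsNoetherianRing R] (S : Set R)
    (hS : ∀ c ∈ S, ∀ g : M, ∃ x y : MvPolynomial (Fin (e + 2)) k,
      IsWeightedHomogeneous w x (-g) ∧ IsWeightedHomogeneous w y g ∧ y * x = c) :
    Ideal.span S ^ (e + 1) ≤ cohomologyAnnihilatorOfDegree R (e + 3) := by
  obtain ⟨ρ, hρ, -⟩ := exists_retraction_of_degree_zero k w R hR
  have hP : cohomologyAnnihilatorOfDegree (MvPolynomial (Fin (e + 2)) k) (e + 3) = ⊤ :=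
    cohomologyAnnihilatorOfDegree_mvPolynomial_eq_top k (e + 2)
  exact span_pow_le_cohomologyAnnihilatorOfDegree (R := R) (P := MvPolynomial (Fin (e + 2)) k) ρ
    (fun r => hρ r) (fun c hc => exists_comp_eq_smul_id_of_graded k w R hR c (hS c hc)) e hP

end GradedGeneral

end Summit.ResolutionOfSingularities.ResolutionOfSingularities.Theorems.HomologicalConductor.PersistenceVeroneseExponentTwo

end
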